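import Literature.NumberTheory.Sieve.GoldstonPintzYildirimTwoVarPerron
import Mathlib.NumberTheory.EulerProduct.Basic
import HarnessLib

/-!
# Goldston–Pintz–Yıldırım, *Primes in tuples I*, §7 (7.8): the Euler product of `F(s₁,s₂)`

Trunk: NumberTheory / Sieve, continuing `GoldstonPintzYildirimTwoVarPerron` (the double Dirichlet
series `F(s₁,s₂) = FDir₂ H₁ H₂ s₁ s₂ = ∑_{d,e} μ(d)μ(e)(nuJoint(d,e)/[d,e]) d^{−s₁}e^{−s₂}` of (7.7)).
GPY, *Primes in tuples. I* (Ann. of Math. 170 (2009) = arXiv:math/0508185), §7, p. 14, (7.8):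

  `F(s₁,s₂) = ∏_p (1 − ν_p(H₁) p^{−1−s₁} − ν_p(H₂) p^{−1−s₂} + ν̄_p(H₁∩̄H₂) p^{−1−s₁−s₂})`.

Everything here is PROVED. The proof organises the pairs `(d,e)` by `q = [d,e]`:

* `Literature.NumberTheory.Sieve.GPY.lcmFiberSum H₁ H₂ s₁ s₂ q = ∑_{[d,e] = q} c(d,e) d^{−s₁} e^{−s₂}` — an arithmetic function of `q`
  with `lcmFiberSum 0 = 0`, `lcmFiberSum 1 = 1`;
* `lcm_mul_mul_of_coprime`, `nuJoint_mul_mul`, `FDir₂Term_mul_mul` — for `(m,n) = 1`,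
  `d₁, e₁ ∣ m`, `d₂, e₂ ∣ n`: `[d₁d₂, e₁e₂] = [d₁,e₁][d₂,e₂]`, and the coefficient
  `nuJoint`, hence the term `c(d,e)d^{−s₁}e^{−s₂}`, is multiplicative in the pair;
  `lcmFiberSum_mul_of_coprime` — so `q ↦ lcmFiberSum q` is multiplicative;
* `lcmFiberSum_prime`, `lcmFiberSum_prime_pow` — at a prime the fibre is `{(p,1),(1,p),(p,p)}`,
  giving `−ν_p(H₁)p^{−1−s₁} − ν_p(H₂)p^{−1−s₂} + ν̄_p p^{−1−s₁−s₂}`; at `p^e`, `e ≥ 2`, it is `0`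
  (`μ`);
* `hasSum_lcmFiberSum` — `∑_q lcmFiberSum q = F(s₁,s₂)` (fibrewise resummation of the absolutely
  convergent double series, `HasSum.tsum_fiberwise`), `summable_norm_lcmFiberSum`;
* `Literature.NumberTheory.Sieve.GPY.F₂Factor` — the Euler factor of (7.8), and `hasProd_F₂Factor` — **(7.8)**:
  `HasProd (p ↦ F₂Factor H₁ H₂ p s₁ s₂) (F(s₁,s₂))` for `Re s₁, Re s₂ ≥ 1`
  (Mathlib's `EulerProduct.eulerProduct_hasProd`), `FDir₂_eq_tprod`.

The factorisation (7.9) `F = G ζ(1+s₁+s₂)^r ζ(1+s₁)^{−k₁} ζ(1+s₂)^{−k₂}` and the analysis of `G`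
((7.10)–(7.12)) are the next steps of the source (not here).

## References

* D. A. Goldston, J. Pintz, C. Y. Yıldırım, *Primes in tuples. I*, Ann. of Math. (2) 170 (2009),
  819–862 = arXiv:math/0508185, §7, (7.4)–(7.5), (7.8), p. 14. [cite: GoldstonPintzYildirim2009]
-/

noncomputable section

open Finset Complex
open scoped ArithmeticFunction.Moebius ArithmeticFunction.omega

namespace Literature.NumberTheory.Sieve.GPY

/-! ### The fibre sums over `[d,e] = q` -/

/-- The pairs of divisors of `q` with least common multiple `q` (the fibre of `(d,e) ↦ [d,e]`;
empty for `q = 0`). [folklore] -/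
def lcmFiber (q : ℕ) : Finset (ℕ × ℕ) :=
  (q.divisors ×ˢ q.divisors).filter fun p => Nat.lcm p.1 p.2 = q

/-- Membership in the fibre: for `q ≠ 0`, `(d,e) ∈ lcmFiber q ↔ [d,e] = q`. [folklore] -/
theorem mem_lcmFiber {q : ℕ} (hq : q ≠ 0) {p : ℕ × ℕ} : p ∈ lcmFiber q ↔ Nat.lcm p.1 p.2 = q := by
  unfold lcmFiber
  rw [Finset.mem_filter, Finset.mem_product, Nat.mem_divisors, Nat.mem_divisors]
  constructor
  · exact fun h => h.2
  · intro h
    refine ⟨⟨⟨?_, hq⟩, ⟨?_, hq⟩⟩, h⟩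
    · rw [← h]; exact Nat.dvd_lcm_left _ _
    · rw [← h]; exact Nat.dvd_lcm_right _ _

/-- `lcmFiber 0 = ∅`. [folklore] -/
theorem lcmFiber_zero : lcmFiber 0 = ∅ := by simp [lcmFiber]

/-- The arithmetic function `q ↦ ∑_{[d,e] = q} c(d,e) d^{−s₁} e^{−s₂}` obtained by grouping the terms
of `F(s₁,s₂)` ((7.8)) according to `q = [d,e] = a₁a₂a₁₂`.
[cite: GoldstonPintzYildirim2009, Section 7 eq. 7.8] -/
def lcmFiberSum (H₁ H₂ : Finset ℕ) (s₁ s₂ : ℂ) (q : ℕ) : ℂ :=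
  ∑ p ∈ lcmFiber q, FDir₂Term H₁ H₂ s₁ s₂ p

/-- `lcmFiberSum 0 = 0`. [folklore] -/
theorem lcmFiberSum_zero (H₁ H₂ : Finset ℕ) (s₁ s₂ : ℂ) : lcmFiberSum H₁ H₂ s₁ s₂ 0 = 0 := by
  simp [lcmFiberSum, lcmFiber_zero]

/-- `nuJoint(1,1) = 1` (empty product). [folklore] -/
theorem nuJoint_one_one (H₁ H₂ : Finset ℕ) : nuJoint H₁ H₂ 1 1 = 1 := by
  simp [nuJoint]

/-- `c(1,1) = 1`. [folklore] -/
theorem pairCoeff_one_one (H₁ H₂ : Finset ℕ) : pairCoeff H₁ H₂ 1 1 = 1 := by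
  simp [pairCoeff, nuJoint_one_one]

/-- `lcmFiberSum 1 = 1` (the fibre is `{(1,1)}`). [folklore] -/
theorem lcmFiberSum_one (H₁ H₂ : Finset ℕ) (s₁ s₂ : ℂ) : lcmFiberSum H₁ H₂ s₁ s₂ 1 = 1 := by
  have h : lcmFiber 1 = {(1, 1)} := by
    ext ⟨d, e⟩
    rw [mem_lcmFiber one_ne_zero, Finset.mem_singleton, Prod.mk.injEq]
    constructor
    · intro h
      exact ⟨Nat.eq_one_of_dvd_one (h ▸ Nat.dvd_lcm_left d e),
        Nat.eq_one_of_dvd_one (h ▸ Nat.dvd_lcm_right d e)⟩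
    · rintro ⟨rfl, rfl⟩; simp
  rw [lcmFiberSum, h, Finset.sum_singleton, FDir₂Term]
  simp [pairCoeff_one_one]

/-! ### Multiplicativity -/

/-- For `(m,n) = 1`, `d₁, e₁ ∣ m`, `d₂, e₂ ∣ n`: `[d₁d₂, e₁e₂] = [d₁,e₁] · [d₂,e₂]`. [folklore] -/
theorem lcm_mul_mul_of_coprime {m n d₁ e₁ d₂ e₂ : ℕ} (hmn : m.Coprime n) (hd₁ : d₁ ∣ m)
    (he₁ : e₁ ∣ m) (hd₂ : d₂ ∣ n) (he₂ : e₂ ∣ n) :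
    Nat.lcm (d₁ * d₂) (e₁ * e₂) = Nat.lcm d₁ e₁ * Nat.lcm d₂ e₂ := by
  apply Nat.dvd_antisymm
  · exact Nat.lcm_dvd (mul_dvd_mul (Nat.dvd_lcm_left _ _) (Nat.dvd_lcm_left _ _))
      (mul_dvd_mul (Nat.dvd_lcm_right _ _) (Nat.dvd_lcm_right _ _))
  · have h1 : Nat.lcm d₁ e₁ ∣ m := Nat.lcm_dvd hd₁ he₁
    have h2 : Nat.lcm d₂ e₂ ∣ n := Nat.lcm_dvd hd₂ he₂
    have hcop : (Nat.lcm d₁ e₁).Coprime (Nat.lcm d₂ e₂) :=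
      (hmn.coprime_dvd_left h1).coprime_dvd_right h2
    refine hcop.mul_dvd_of_dvd_of_dvd ?_ ?_
    · exact Nat.lcm_dvd ((dvd_mul_right d₁ d₂).trans (Nat.dvd_lcm_left _ _))
        ((dvd_mul_right e₁ e₂).trans (Nat.dvd_lcm_right _ _))
    · exact Nat.lcm_dvd ((dvd_mul_left d₂ d₁).trans (Nat.dvd_lcm_left _ _))
        ((dvd_mul_left e₂ e₁).trans (Nat.dvd_lcm_right _ _))

/-- A prime dividing `m` divides `d₁d₂` (`d₂ ∣ n`, `(m,n) = 1`) iff it divides `d₁`. [folklore] -/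
theorem prime_dvd_mul_iff_of_coprime {m n p d₁ d₂ : ℕ} (hmn : m.Coprime n) (hp : p.Prime)
    (hpm : p ∣ m) (hd₂ : d₂ ∣ n) : p ∣ d₁ * d₂ ↔ p ∣ d₁ := by
  constructor
  · intro h
    rcases hp.dvd_mul.1 h with h | h
    · exact h
    · exact absurd (Nat.eq_one_of_dvd_coprimes hmn hpm (h.trans hd₂)) hp.one_lt.ne'
  · exact fun h => h.mul_right _

/-- A prime dividing `n` divides `d₁d₂` (`d₁ ∣ m`, `(m,n) = 1`) iff it divides `d₂`. [folklore] -/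
theorem prime_dvd_mul_iff_of_coprime' {m n p d₁ d₂ : ℕ} (hmn : m.Coprime n) (hp : p.Prime)
    (hpn : p ∣ n) (hd₁ : d₁ ∣ m) : p ∣ d₁ * d₂ ↔ p ∣ d₂ := by
  rw [mul_comm]
  exact prime_dvd_mul_iff_of_coprime hmn.symm hp hpn hd₁

/-- **`nuJoint` is multiplicative in the pair**: for `(m,n) = 1`, `d₁, e₁ ∣ m`, `d₂, e₂ ∣ n`,
`nuJoint(d₁d₂, e₁e₂) = nuJoint(d₁,e₁) · nuJoint(d₂,e₂)` (the local factor at `p ∣ [d₁,e₁]`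
only sees `d₁, e₁`). [cite: GoldstonPintzYildirim2009, Section 7 eq. 7.4] -/
theorem nuJoint_mul_mul (H₁ H₂ : Finset ℕ) {m n d₁ e₁ d₂ e₂ : ℕ} (hmn : m.Coprime n)
    (hd₁ : d₁ ∣ m) (he₁ : e₁ ∣ m) (hd₂ : d₂ ∣ n) (he₂ : e₂ ∣ n) :
    nuJoint H₁ H₂ (d₁ * d₂) (e₁ * e₂) = nuJoint H₁ H₂ d₁ e₁ * nuJoint H₁ H₂ d₂ e₂ := by
  have h1 : Nat.lcm d₁ e₁ ∣ m := Nat.lcm_dvd hd₁ he₁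
  have h2 : Nat.lcm d₂ e₂ ∣ n := Nat.lcm_dvd hd₂ he₂
  have hcop : (Nat.lcm d₁ e₁).Coprime (Nat.lcm d₂ e₂) :=
    (hmn.coprime_dvd_left h1).coprime_dvd_right h2
  unfold nuJoint
  rw [lcm_mul_mul_of_coprime hmn hd₁ he₁ hd₂ he₂, hcop.primeFactors_mul,
    Finset.prod_union hcop.disjoint_primeFactors]
  congr 1
  · refine Finset.prod_congr rfl fun p hp => ?_
    have hpp := Nat.prime_of_mem_primeFactors hp
    have hpm : p ∣ m := (Nat.dvd_of_mem_primeFactors hp).trans h1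
    unfold nuJointPrime
    simp only [prime_dvd_mul_iff_of_coprime hmn hpp hpm hd₂,
      prime_dvd_mul_iff_of_coprime hmn hpp hpm he₂]
  · refine Finset.prod_congr rfl fun p hp => ?_
    have hpp := Nat.prime_of_mem_primeFactors hp
    have hpn : p ∣ n := (Nat.dvd_of_mem_primeFactors hp).trans h2
    unfold nuJointPrime
    simp only [prime_dvd_mul_iff_of_coprime' hmn hpp hpn hd₁,
      prime_dvd_mul_iff_of_coprime' hmn hpp hpn he₁]

/-- **`c(d,e)` is multiplicative in the pair**: for `(m,n) = 1`, `d₁, e₁ ∣ m`, `d₂, e₂ ∣ n`,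
`c(d₁d₂, e₁e₂) = c(d₁,e₁) c(d₂,e₂)`. [cite: GoldstonPintzYildirim2009, Section 7 eq. 7.8] -/
theorem pairCoeff_mul_mul (H₁ H₂ : Finset ℕ) {m n d₁ e₁ d₂ e₂ : ℕ} (hmn : m.Coprime n)
    (hd₁ : d₁ ∣ m) (he₁ : e₁ ∣ m) (hd₂ : d₂ ∣ n) (he₂ : e₂ ∣ n) :
    pairCoeff H₁ H₂ (d₁ * d₂) (e₁ * e₂) = pairCoeff H₁ H₂ d₁ e₁ * pairCoeff H₁ H₂ d₂ e₂ := by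
  have hdd : d₁.Coprime d₂ := (hmn.coprime_dvd_left hd₁).coprime_dvd_right hd₂
  have hee : e₁.Coprime e₂ := (hmn.coprime_dvd_left he₁).coprime_dvd_right he₂
  unfold pairCoeff
  rw [ArithmeticFunction.isMultiplicative_moebius.map_mul_of_coprime hdd,
    ArithmeticFunction.isMultiplicative_moebius.map_mul_of_coprime hee,
    nuJoint_mul_mul H₁ H₂ hmn hd₁ he₁ hd₂ he₂, lcm_mul_mul_of_coprime hmn hd₁ he₁ hd₂ he₂]
  push_cast
  rw [mul_div_mul_comm]
  ring

/-- **The term `c(d,e) d^{−s₁} e^{−s₂}` is multiplicative in the pair** (same hypotheses).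
[cite: GoldstonPintzYildirim2009, Section 7 eq. 7.8] -/
theorem FDir₂Term_mul_mul (H₁ H₂ : Finset ℕ) (s₁ s₂ : ℂ) {m n d₁ e₁ d₂ e₂ : ℕ} (hmn : m.Coprime n)
    (hd₁ : d₁ ∣ m) (he₁ : e₁ ∣ m) (hd₂ : d₂ ∣ n) (he₂ : e₂ ∣ n) :
    FDir₂Term H₁ H₂ s₁ s₂ (d₁ * d₂, e₁ * e₂) =
      FDir₂Term H₁ H₂ s₁ s₂ (d₁, e₁) * FDir₂Term H₁ H₂ s₁ s₂ (d₂, e₂) := by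
  unfold FDir₂Term
  dsimp only
  rw [pairCoeff_mul_mul H₁ H₂ hmn hd₁ he₁ hd₂ he₂]
  push_cast
  rw [Complex.natCast_mul_natCast_cpow, Complex.natCast_mul_natCast_cpow, mul_div_mul_comm]
  ring

/-- A sum over the divisors of a product of coprime numbers is a double sum. [folklore] -/
theorem sum_divisors_mul_eq {M : Type*} [AddCommMonoid M] {m n : ℕ} (hmn : m.Coprime n)
    (f : ℕ → M) :
    ∑ d ∈ (m * n).divisors, f d = ∑ a ∈ m.divisors, ∑ b ∈ n.divisors, f (a * b) := by
  rw [Nat.divisors_mul, ← Finset.image_mul_product, Finset.sum_image hmn.mul_injOn_divisors,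
    Finset.sum_product]

/-- For `a ∣ m`, `b ∣ n` (`m, n ≠ 0`): `ab = mn ↔ a = m ∧ b = n`. [folklore] -/
theorem mul_eq_mul_iff_of_dvd {m n a b : ℕ} (hm : m ≠ 0) (hn : n ≠ 0) (ha : a ∣ m) (hb : b ∣ n) :
    a * b = m * n ↔ a = m ∧ b = n := by
  constructor
  · intro h
    have ha' : a ≤ m := Nat.le_of_dvd (Nat.pos_of_ne_zero hm) ha
    have hb' : b ≤ n := Nat.le_of_dvd (Nat.pos_of_ne_zero hn) hb
    have hma : a = m := by
      by_contra hne
      have hlt : a < m := lt_of_le_of_ne ha' hne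
      have : a * b < m * n :=
        calc a * b ≤ a * n := Nat.mul_le_mul_left a hb'
          _ < m * n := Nat.mul_lt_mul_of_pos_right hlt (Nat.pos_of_ne_zero hn)
      omega
    subst hma
    exact ⟨rfl, Nat.eq_of_mul_eq_mul_left (Nat.pos_of_ne_zero hm) h⟩
  · rintro ⟨rfl, rfl⟩; rfl

/-- **Multiplicativity of the fibre sums**: `lcmFiberSum (mn) = lcmFiberSum m · lcmFiberSum n`
for `(m,n) = 1`. [cite: GoldstonPintzYildirim2009, Section 7 eq. 7.8] -/
theorem lcmFiberSum_mul_of_coprime (H₁ H₂ : Finset ℕ) (s₁ s₂ : ℂ) {m n : ℕ} (hmn : m.Coprime n) :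
    lcmFiberSum H₁ H₂ s₁ s₂ (m * n) = lcmFiberSum H₁ H₂ s₁ s₂ m * lcmFiberSum H₁ H₂ s₁ s₂ n := by
  rcases Nat.eq_zero_or_pos m with rfl | hm
  · simp [lcmFiberSum_zero]
  rcases Nat.eq_zero_or_pos n with rfl | hn
  · simp [lcmFiberSum_zero]
  set t := FDir₂Term H₁ H₂ s₁ s₂ with ht
  -- fibre sums as indicator sums over all pairs of divisors
  have hind : ∀ q : ℕ, lcmFiberSum H₁ H₂ s₁ s₂ q =
      ∑ d ∈ q.divisors, ∑ e ∈ q.divisors, if Nat.lcm d e = q then t (d, e) else 0 := by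
    intro q
    rw [lcmFiberSum, lcmFiber, Finset.sum_filter, Finset.sum_product]
  rw [hind, hind, hind, sum_divisors_mul_eq hmn]
  simp_rw [sum_divisors_mul_eq hmn]
  -- the summand factors
  have hfac : ∀ d₁ ∈ m.divisors, ∀ d₂ ∈ n.divisors, ∀ e₁ ∈ m.divisors, ∀ e₂ ∈ n.divisors,
      (if Nat.lcm (d₁ * d₂) (e₁ * e₂) = m * n then t (d₁ * d₂, e₁ * e₂) else 0) =
        (if Nat.lcm d₁ e₁ = m then t (d₁, e₁) else 0) *
          (if Nat.lcm d₂ e₂ = n then t (d₂, e₂) else 0) := by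
    intro d₁ hd₁ d₂ hd₂ e₁ he₁ e₂ he₂
    have hd₁' := Nat.dvd_of_mem_divisors hd₁
    have hd₂' := Nat.dvd_of_mem_divisors hd₂
    have he₁' := Nat.dvd_of_mem_divisors he₁
    have he₂' := Nat.dvd_of_mem_divisors he₂
    rw [lcm_mul_mul_of_coprime hmn hd₁' he₁' hd₂' he₂']
    have hiff := mul_eq_mul_iff_of_dvd hm.ne' hn.ne' (Nat.lcm_dvd hd₁' he₁') (Nat.lcm_dvd hd₂' he₂')
    by_cases h1 : Nat.lcm d₁ e₁ = m
    · by_cases h2 : Nat.lcm d₂ e₂ = n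
      · rw [if_pos (hiff.2 ⟨h1, h2⟩), if_pos h1, if_pos h2, ht,
          FDir₂Term_mul_mul H₁ H₂ s₁ s₂ hmn hd₁' he₁' hd₂' he₂']
      · rw [if_neg (fun h => h2 (hiff.1 h).2), if_neg h2, mul_zero]
    · rw [if_neg (fun h => h1 (hiff.1 h).1), if_neg h1, zero_mul]
  -- rearrange the quadruple sum
  calc ∑ d₁ ∈ m.divisors, ∑ d₂ ∈ n.divisors, ∑ e₁ ∈ m.divisors, ∑ e₂ ∈ n.divisors,
        (if Nat.lcm (d₁ * d₂) (e₁ * e₂) = m * n then t (d₁ * d₂, e₁ * e₂) else 0)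
      = ∑ d₁ ∈ m.divisors, ∑ d₂ ∈ n.divisors, ∑ e₁ ∈ m.divisors, ∑ e₂ ∈ n.divisors,
          (if Nat.lcm d₁ e₁ = m then t (d₁, e₁) else 0) *
            (if Nat.lcm d₂ e₂ = n then t (d₂, e₂) else 0) := by
        refine Finset.sum_congr rfl fun d₁ hd₁ => Finset.sum_congr rfl fun d₂ hd₂ =>
          Finset.sum_congr rfl fun e₁ he₁ => Finset.sum_congr rfl fun e₂ he₂ => ?_
        exact hfac d₁ hd₁ d₂ hd₂ e₁ he₁ e₂ he₂
    _ = ∑ d₁ ∈ m.divisors, ∑ e₁ ∈ m.divisors, ∑ d₂ ∈ n.divisors, ∑ e₂ ∈ n.divisors,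
          (if Nat.lcm d₁ e₁ = m then t (d₁, e₁) else 0) *
            (if Nat.lcm d₂ e₂ = n then t (d₂, e₂) else 0) := by
        refine Finset.sum_congr rfl fun d₁ _ => ?_
        rw [Finset.sum_comm]
    _ = (∑ d₁ ∈ m.divisors, ∑ e₁ ∈ m.divisors, if Nat.lcm d₁ e₁ = m then t (d₁, e₁) else 0) *
          ∑ d₂ ∈ n.divisors, ∑ e₂ ∈ n.divisors, if Nat.lcm d₂ e₂ = n then t (d₂, e₂) else 0 := by
        rw [Finset.sum_mul]
        refine Finset.sum_congr rfl fun d₁ _ => ?_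
        rw [Finset.sum_mul]
        refine Finset.sum_congr rfl fun e₁ _ => ?_
        rw [Finset.mul_sum]
        refine Finset.sum_congr rfl fun d₂ _ => ?_
        rw [Finset.mul_sum]

/-! ### Values at prime powers -/

/-- A nonzero term has squarefree `[d,e]` (`μ(d)μ(e) ≠ 0` forces `d, e` squarefree).
[folklore] -/
theorem squarefree_lcm_of_FDir₂Term_ne_zero (H₁ H₂ : Finset ℕ) (s₁ s₂ : ℂ) {d e : ℕ}
    (h : FDir₂Term H₁ H₂ s₁ s₂ (d, e) ≠ 0) : Squarefree (Nat.lcm d e) := by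
  have hd : Squarefree d := by
    by_contra hd
    apply h
    simp [FDir₂Term, pairCoeff, ArithmeticFunction.moebius_eq_zero_of_not_squarefree hd]
  have he : Squarefree e := by
    by_contra he
    apply h
    simp [FDir₂Term, pairCoeff, ArithmeticFunction.moebius_eq_zero_of_not_squarefree he]
  have hd0 := hd.ne_zero
  have he0 := he.ne_zero
  rw [Nat.squarefree_iff_factorization_le_one (Nat.lcm_ne_zero hd0 he0)]
  intro p
  rw [Nat.factorization_lcm hd0 he0, Finsupp.sup_apply]
  exact sup_le ((Nat.squarefree_iff_factorization_le_one hd0).1 hd p)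
    ((Nat.squarefree_iff_factorization_le_one he0).1 he p)

/-- `lcmFiberSum (p^e) = 0` for `e ≥ 2` (no squarefree number is `[d,e] = p^e`). [folklore] -/
theorem lcmFiberSum_prime_pow (H₁ H₂ : Finset ℕ) (s₁ s₂ : ℂ) {p : ℕ} (hp : p.Prime) {e : ℕ}
    (he : 2 ≤ e) : lcmFiberSum H₁ H₂ s₁ s₂ (p ^ e) = 0 := by
  refine Finset.sum_eq_zero fun q hq => ?_
  rw [mem_lcmFiber (pow_ne_zero e hp.ne_zero)] at hq
  by_contra hne
  obtain ⟨d, e'⟩ := q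
  have hsq := squarefree_lcm_of_FDir₂Term_ne_zero H₁ H₂ s₁ s₂ hne
  rw [hq] at hsq
  have h2 : p * p ∣ p ^ e := by
    rw [← sq]; exact pow_dvd_pow p he
  exact hp.one_lt.ne' (Nat.isUnit_iff.1 (hsq p h2))

/-- `nuJoint(p,1) = ν_p(H₁)`, `nuJoint(1,p) = ν_p(H₂)`, `nuJoint(p,p) = ν̄_p` at a prime `p`.
[cite: GoldstonPintzYildirim2009, Section 7 eq. 7.4] -/
theorem nuJoint_prime (H₁ H₂ : Finset ℕ) {p : ℕ} (hp : p.Prime) :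
    nuJoint H₁ H₂ p 1 = nuPrime H₁ p ∧ nuJoint H₁ H₂ 1 p = nuPrime H₂ p ∧
      nuJoint H₁ H₂ p p = nuBar H₁ H₂ p := by
  refine ⟨?_, ?_, ?_⟩ <;> simp [nuJoint, nuJointPrime, hp.primeFactors, hp.ne_one]

/-- **The fibre sum at a prime**: `lcmFiberSum p = −ν_p(H₁) p^{−1−s₁} − ν_p(H₂) p^{−1−s₂} + ν̄_p p^{−1−s₁−s₂}`
(the fibre is `{(p,1), (1,p), (p,p)}`), written with `p^{−1−s} = (p · p^{s})⁻¹`.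
[cite: GoldstonPintzYildirim2009, Section 7 eq. 7.8] -/
theorem lcmFiberSum_prime (H₁ H₂ : Finset ℕ) (s₁ s₂ : ℂ) {p : ℕ} (hp : p.Prime) :
    lcmFiberSum H₁ H₂ s₁ s₂ p =
      -(nuPrime H₁ p : ℂ) / ((p : ℂ) * (p : ℂ) ^ s₁) - (nuPrime H₂ p : ℂ) / ((p : ℂ) * (p : ℂ) ^ s₂) +
        (nuBar H₁ H₂ p : ℂ) / ((p : ℂ) * ((p : ℂ) ^ s₁ * (p : ℂ) ^ s₂)) := by
  obtain ⟨hν1, hν2, hν12⟩ := nuJoint_prime H₁ H₂ hp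
  have hp1 : (1 : ℕ) ≠ p := hp.one_lt.ne
  have hfib : lcmFiberSum H₁ H₂ s₁ s₂ p =
      ∑ d ∈ ({1, p} : Finset ℕ), ∑ e ∈ ({1, p} : Finset ℕ),
        if Nat.lcm d e = p then FDir₂Term H₁ H₂ s₁ s₂ (d, e) else 0 := by
    rw [lcmFiberSum, lcmFiber, Finset.sum_filter, Finset.sum_product, hp.divisors]
  rw [hfib, Finset.sum_pair hp1, Finset.sum_pair hp1, Finset.sum_pair hp1]
  have h11 : ¬ Nat.lcm 1 1 = p := by rw [Nat.lcm_self]; exact hp1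
  rw [if_neg h11, if_pos (Nat.lcm_one_left p), if_pos (Nat.lcm_one_right p), if_pos (Nat.lcm_self p)]
  simp only [FDir₂Term, pairCoeff, hν1, hν2, hν12, ArithmeticFunction.moebius_apply_prime hp,
    ArithmeticFunction.moebius_apply_one, Nat.lcm_one_left, Nat.lcm_one_right, Nat.lcm_self,
    Nat.cast_one, Complex.one_cpow]
  push_cast
  ring

/-! ### Fibrewise resummation: `∑_q lcmFiberSum q = F(s₁,s₂)` -/

/-- The fibre of `(d,e) ↦ [d,e]` over `q ≠ 0` is the finite set `lcmFiber q`. [folklore] -/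
theorem preimage_lcm_eq {q : ℕ} (hq : q ≠ 0) :
    (fun p : ℕ × ℕ => Nat.lcm p.1 p.2) ⁻¹' {q} = ↑(lcmFiber q) := by
  ext p
  rw [Set.mem_preimage, Set.mem_singleton_iff, Finset.mem_coe, mem_lcmFiber hq]

/-- On the fibre over `0` (the pairs with `d = 0` or `e = 0`) every term vanishes. [folklore] -/
theorem FDir₂Term_eq_zero_of_lcm_eq_zero (H₁ H₂ : Finset ℕ) (s₁ s₂ : ℂ) {p : ℕ × ℕ}
    (hp : Nat.lcm p.1 p.2 = 0) : FDir₂Term H₁ H₂ s₁ s₂ p = 0 := by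
  obtain ⟨d, e⟩ := p
  rcases Nat.lcm_eq_zero_iff.1 hp with h | h
  · simp only at h; subst h; simp [FDir₂Term, pairCoeff_zero_left]
  · simp only at h; subst h; simp [FDir₂Term, pairCoeff_zero_right]

/-- Fibrewise resummation of an absolutely convergent family on `ℕ × ℕ` along `(d,e) ↦ [d,e]`:
if `∑ g = a`, all terms on the fibre over `0` vanish, then `∑_q (∑_{[d,e]=q} g) = a`. [folklore] -/
theorem hasSum_sum_lcmFiber {g : ℕ × ℕ → ℂ} {a : ℂ} (hg : HasSum g a)
    (h0 : ∀ p : ℕ × ℕ, Nat.lcm p.1 p.2 = 0 → g p = 0) :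
    HasSum (fun q : ℕ => ∑ p ∈ lcmFiber q, g p) a := by
  have h := hg.tsum_fiberwise (fun p : ℕ × ℕ => Nat.lcm p.1 p.2)
  have heq : (fun q : ℕ => ∑' p : (fun p : ℕ × ℕ => Nat.lcm p.1 p.2) ⁻¹' {q}, g p) =
      fun q : ℕ => ∑ p ∈ lcmFiber q, g p := by
    funext q
    rcases Nat.eq_zero_or_pos q with rfl | hq
    · rw [lcmFiber_zero, Finset.sum_empty]
      have : ∀ p : (fun p : ℕ × ℕ => Nat.lcm p.1 p.2) ⁻¹' {(0 : ℕ)}, g p = 0 :=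
        fun p => h0 p.1 p.2
      simp [this]
    · rw [preimage_lcm_eq hq.ne', Finset.tsum_subtype']
  rwa [heq] at h

/-- **`∑_q lcmFiberSum q = F(s₁,s₂)`** for `Re s₁, Re s₂ ≥ 1` (and `k₁ + k₂ ≥ 1`).
[cite: GoldstonPintzYildirim2009, Section 7 eq. 7.8] -/
theorem hasSum_lcmFiberSum (H₁ H₂ : Finset ℕ) (hk : 1 ≤ #H₁ + #H₂) {s₁ s₂ : ℂ}
    (hs₁ : 1 ≤ s₁.re) (hs₂ : 1 ≤ s₂.re) :
    HasSum (lcmFiberSum H₁ H₂ s₁ s₂) (FDir₂ H₁ H₂ s₁ s₂) :=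
  hasSum_sum_lcmFiber (summable_FDir₂Term H₁ H₂ hk hs₁ hs₂).hasSum
    (fun _ hp => FDir₂Term_eq_zero_of_lcm_eq_zero H₁ H₂ s₁ s₂ hp)

/-- `∑_q ‖lcmFiberSum q‖ < ∞` for `Re s₁, Re s₂ ≥ 1` (by the same resummation applied to the
norms). [cite: GoldstonPintzYildirim2009, Section 7 eq. 7.8] -/
theorem summable_norm_lcmFiberSum (H₁ H₂ : Finset ℕ) (hk : 1 ≤ #H₁ + #H₂) {s₁ s₂ : ℂ}
    (hs₁ : 1 ≤ s₁.re) (hs₂ : 1 ≤ s₂.re) :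
    Summable fun q : ℕ => ‖lcmFiberSum H₁ H₂ s₁ s₂ q‖ := by
  have hN : Summable fun p : ℕ × ℕ => ((‖FDir₂Term H₁ H₂ s₁ s₂ p‖ : ℝ) : ℂ) := by
    have := summable_norm_FDir₂Term H₁ H₂ hk hs₁ hs₂
    exact (Complex.ofRealCLM.summable this)
  have hfib := hasSum_sum_lcmFiber hN.hasSum (fun p hp => by
    rw [FDir₂Term_eq_zero_of_lcm_eq_zero H₁ H₂ s₁ s₂ hp, norm_zero, Complex.ofReal_zero])
  have hre : Summable fun q : ℕ => ∑ p ∈ lcmFiber q, ‖FDir₂Term H₁ H₂ s₁ s₂ p‖ := by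
    have := (Complex.reCLM.summable hfib.summable)
    refine this.congr fun q => ?_
    simp
  refine Summable.of_nonneg_of_le (fun q => norm_nonneg _) (fun q => ?_) hre
  exact norm_sum_le _ _

/-! ### The Euler product (7.8) -/

/-- GPY's Euler factor of `F(s₁,s₂)` ((7.8)):
`1 − ν_p(H₁) p^{−(1+s₁)} − ν_p(H₂) p^{−(1+s₂)} + ν̄_p(H₁∩̄H₂) p^{−(1+s₁+s₂)}`.
[cite: GoldstonPintzYildirim2009, Section 7 eq. 7.8] -/
def F₂Factor (H₁ H₂ : Finset ℕ) (p : ℕ) (s₁ s₂ : ℂ) : ℂ :=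
  1 - (nuPrime H₁ p : ℂ) / (p : ℂ) ^ (1 + s₁) - (nuPrime H₂ p : ℂ) / (p : ℂ) ^ (1 + s₂) +
    (nuBar H₁ H₂ p : ℂ) / (p : ℂ) ^ (1 + s₁ + s₂)

/-- The local factor of the Euler product of `q ↦ lcmFiberSum q`:
`∑_e lcmFiberSum (p^e) = 1 + lcmFiberSum p = F₂Factor p`. [cite: GoldstonPintzYildirim2009, Section 7 eq. 7.8] -/
theorem tsum_lcmFiberSum_prime_pow (H₁ H₂ : Finset ℕ) (s₁ s₂ : ℂ) {p : ℕ} (hp : p.Prime) :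
    ∑' e : ℕ, lcmFiberSum H₁ H₂ s₁ s₂ (p ^ e) = F₂Factor H₁ H₂ p s₁ s₂ := by
  have h01 : ∀ e : ℕ, e ∉ ({0, 1} : Finset ℕ) → lcmFiberSum H₁ H₂ s₁ s₂ (p ^ e) = 0 := by
    intro e he
    simp only [Finset.mem_insert, Finset.mem_singleton, not_or] at he
    exact lcmFiberSum_prime_pow H₁ H₂ s₁ s₂ hp (by omega)
  rw [tsum_eq_sum h01, Finset.sum_pair (by norm_num), pow_zero, pow_one, lcmFiberSum_one,
    lcmFiberSum_prime H₁ H₂ s₁ s₂ hp, F₂Factor]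
  have hp0 : (p : ℂ) ≠ 0 := by exact_mod_cast hp.ne_zero
  have hps₁ : (p : ℂ) ^ s₁ ≠ 0 := Complex.cpow_ne_zero_iff.2 (Or.inl hp0)
  have hps₂ : (p : ℂ) ^ s₂ ≠ 0 := Complex.cpow_ne_zero_iff.2 (Or.inl hp0)
  simp only [Complex.cpow_add _ _ hp0, Complex.cpow_one]
  field_simp
  ring

/-- **GPY (7.8), the Euler product of `F(s₁,s₂)`**: for `Re s₁, Re s₂ ≥ 1` (and `k₁ + k₂ ≥ 1`),
`HasProd (p ↦ 1 − ν_p(H₁)p^{−1−s₁} − ν_p(H₂)p^{−1−s₂} + ν̄_p p^{−1−s₁−s₂}) (F(s₁,s₂))`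
(unconditional product over `Nat.Primes`; Mathlib's `EulerProduct.eulerProduct_hasProd` applied to
the multiplicative, absolutely summable `q ↦ lcmFiberSum q`).
[cite: GoldstonPintzYildirim2009, Section 7 eq. 7.8] -/
theorem hasProd_F₂Factor (H₁ H₂ : Finset ℕ) (hk : 1 ≤ #H₁ + #H₂) {s₁ s₂ : ℂ}
    (hs₁ : 1 ≤ s₁.re) (hs₂ : 1 ≤ s₂.re) :
    HasProd (fun p : Nat.Primes => F₂Factor H₁ H₂ p s₁ s₂) (FDir₂ H₁ H₂ s₁ s₂) := by
  have h := EulerProduct.eulerProduct_hasProd (f := lcmFiberSum H₁ H₂ s₁ s₂)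
    (lcmFiberSum_one H₁ H₂ s₁ s₂) (fun hab => lcmFiberSum_mul_of_coprime H₁ H₂ s₁ s₂ hab)
    (summable_norm_lcmFiberSum H₁ H₂ hk hs₁ hs₂) (lcmFiberSum_zero H₁ H₂ s₁ s₂)
  have heq : (fun p : Nat.Primes => ∑' e : ℕ, lcmFiberSum H₁ H₂ s₁ s₂ ((p : ℕ) ^ e)) =
      fun p : Nat.Primes => F₂Factor H₁ H₂ p s₁ s₂ :=
    funext fun p => tsum_lcmFiberSum_prime_pow H₁ H₂ s₁ s₂ p.2
  rw [heq, (hasSum_lcmFiberSum H₁ H₂ hk hs₁ hs₂).tsum_eq] at h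
  exact h

/-- **GPY (7.8)** as an identity: `F(s₁,s₂) = ∏'_p F₂Factor p` for `Re s₁, Re s₂ ≥ 1`.
[cite: GoldstonPintzYildirim2009, Section 7 eq. 7.8] -/
theorem FDir₂_eq_tprod (H₁ H₂ : Finset ℕ) (hk : 1 ≤ #H₁ + #H₂) {s₁ s₂ : ℂ}
    (hs₁ : 1 ≤ s₁.re) (hs₂ : 1 ≤ s₂.re) :
    FDir₂ H₁ H₂ s₁ s₂ = ∏' p : Nat.Primes, F₂Factor H₁ H₂ p s₁ s₂ :=
  (hasProd_F₂Factor H₁ H₂ hk hs₁ hs₂).tprod_eq.symm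

end Literature.NumberTheory.Sieve.GPY
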